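import Summits.Ventures.CertifiedManyBodySolver.Downfold.EmeryOrbitalWeightAxisWindow
import HarnessLib

/-!
# STRICT HOLE-LIKENESS FROM THE VAN HOVE DOPING, over a point and over a typed box (INFL-3to1-B §B.94–§B.95; the mirror of
# `EmeryOrbitalWeightAxisWindow` §1 `electronLike_of_xVH_le` and the strict form of `EmeryOrbitalWeightFaceSteps` §2 `faceG_fermiEnergyOf_nonneg_of_xVH`)

Venture CertifiedManyBodySolver, cell `pub/hubbard-downfold` (stage S1), seat hubbard-downfold-mod-4 (technique B, g42); namespace
`Summit.Ventures.CertifiedManyBodySolver.Downfold.Emery`. Everything PROVED (0 sorry; one-line order arguments on the landed closed forms). WHAT THIS IS NOT: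
a statement about any material; `U = 0` one-body kinematics of the σ (d–pₓ–p_y + t_pp, t_pp′) model.

* `faceG_pos_of_vhEnergy_lt` (an energy strictly above the saddle level has `faceG > 0`), `vhEnergy_lt_fermiEnergyOf` (`abFilling(ε_VH) < ν ⇒ ε_VH < ε_F(ν)`),
  **`faceG_fermiEnergyOf_pos_of_lt_xVH`**: `1 − 2ν < x_VH(θ)` (the hole doping `x = 1 − 2ν` is STRICTLY BELOW the σ van Hove doping of the row) ⇒ `0 < faceG(θ; ε_F(θ; ν))`;
  `one_lt_xAxis_of_faceG_pos`: then (with `t_pp′ε_F < t_pd²`) `1 < xAxis(θ; ε_F)` — the antibonding band stays strictly below `ε_F` on the whole Γ–X axis: the Fermi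
  surface is HOLE-LIKE (closed around (π, π)), its ε_F-contour reaches the zone face, and its most Cu-like point is the zone-face (antinodal) crossing
  (`EmeryOrbitalWeightMonotone`).
* **`holeLike_of_le_xVH`** — HOLE-LIKE OVER A WHOLE BOX: if `X ≤ x_VH(θ)` for every member (e.g. `X = 1 − 2Ψhi(q₁)` from `xVH_window_of_vhBoxCheck` and a Ψ-table entry)
  and `1 − 2ν < X`, then every member's Fermi surface at filling `ν` is hole-like: `0 < faceG(θ; ε_F) ∧ 1 < xAxis(θ; ε_F)` (with the box margin `c₂E_h < a₁²`).

Sources: three-band model [HybertsenSchluterChristensen1989, Eq. (1)]; saddle point / axis decoupling [AndersenEtAl1995, §6]; [folklore] algebra.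
-/

noncomputable section

namespace Summit.Ventures.CertifiedManyBodySolver.Downfold.Emery

open Real Set

/-- `ε_VH < ε` (with `Δ + 4t_pp′ ≥ 0`) ⇒ `0 < faceG(ε)`: a contour strictly above the saddle level reaches the zone face in an open arc. [folklore] -/
theorem faceG_pos_of_vhEnergy_lt {Δ tpd c ε : ℝ} (hD : 0 ≤ Δ + 4 * c) (hv : vhEnergy Δ tpd c < ε) : 0 < faceG Δ tpd c ε := by
  have hq := vhEnergy_quad Δ tpd c
  have h0 := vhEnergy_nonneg Δ tpd c
  rw [faceG_eq_quad]
  have : 0 < (ε - vhEnergy Δ tpd c) * (ε + vhEnergy Δ tpd c + (Δ + 4 * c)) := mul_pos (by linarith) (by linarith)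
  nlinarith

/-- **A filling strictly above the van Hove filling has its Fermi energy strictly above the saddle level**: `abFilling(ε_VH) < ν < 1` ⇒ `ε_VH < ε_F(ν)`
(`Δ > 0`, `t_pd ≠ 0`, `0 ≤ t_pp′`, `0 ≤ t_pp`). [folklore] -/
theorem vhEnergy_lt_fermiEnergyOf {Δ a b c ν : ℝ} (hΔ : 0 < Δ) (ha : a ≠ 0) (hc : 0 ≤ c) (hb : 0 ≤ b) (hν0 : 0 < ν) (hν1 : ν < 1)
    (hν : abFilling Δ a b c (vhEnergy Δ a c) < ν) : vhEnergy Δ a c < fermiEnergyOf Δ a b c ν := by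
  by_contra hle
  push Not at hle
  have hF := abFilling_fermiEnergyOf' hΔ ha hc hb hν0 hν1
  have hmono := abFilling_mono Δ a b c hle
  linarith

/-- **STRICT HOLE-LIKENESS FROM THE VAN HOVE DOPING**: `1 − 2ν < x_VH(θ)` ⇒ `0 < faceG(θ; ε_F(θ; ν))` — the ε_F-contour of filling `ν` reaches the zone face. [folklore] -/
theorem faceG_fermiEnergyOf_pos_of_lt_xVH {Δ a b c ν : ℝ} (hΔ : 0 < Δ) (ha : a ≠ 0) (hc : 0 ≤ c) (hb : 0 ≤ b) (hν0 : 0 < ν) (hν1 : ν < 1)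
    (hx : 1 - 2 * ν < xVH Δ a b c) : 0 < faceG Δ a c (fermiEnergyOf Δ a b c ν) := by
  have hν : abFilling Δ a b c (vhEnergy Δ a c) < ν := by unfold xVH at hx; linarith
  exact faceG_pos_of_vhEnergy_lt (by linarith) (vhEnergy_lt_fermiEnergyOf hΔ ha hc hb hν0 hν1 hν)

/-- `0 < faceG(ε)` with `t_pp′ε < t_pd²` ⇒ `1 < xAxis(ε)`: the antibonding band stays strictly below `ε` on the whole Γ–X axis (no axis crossing). [folklore] -/
theorem one_lt_xAxis_of_faceG_pos {Δ tpd c ε : ℝ} (hm : c * ε < tpd ^ 2) (hG : 0 < faceG Δ tpd c ε) : 1 < xAxis Δ tpd c ε := by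
  by_contra hle
  push Not at hle
  exact absurd ((xAxis_le_one_iff hm).1 hle) (not_le.2 hG)

/-- **STRICT HOLE-LIKE TOPOLOGY FROM THE VAN HOVE DOPING**: `1 − 2ν < x_VH(θ)` and `t_pp′·ε_F < t_pd²` ⇒ `0 < faceG(θ; ε_F) ∧ 1 < xAxis(θ; ε_F)` — the Fermi surface
is closed around (π, π) and its most Cu-like point is the zone-face (antinodal) crossing. [folklore] -/
theorem holeLike_of_lt_xVH {Δ a b c ν : ℝ} (hΔ : 0 < Δ) (ha : a ≠ 0) (hc : 0 ≤ c) (hb : 0 ≤ b) (hν0 : 0 < ν) (hν1 : ν < 1)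
    (hx : 1 - 2 * ν < xVH Δ a b c) (hm : c * fermiEnergyOf Δ a b c ν < a ^ 2) :
    0 < faceG Δ a c (fermiEnergyOf Δ a b c ν) ∧ 1 < xAxis Δ a c (fermiEnergyOf Δ a b c ν) :=
  have hG := faceG_fermiEnergyOf_pos_of_lt_xVH hΔ ha hc hb hν0 hν1 hx
  ⟨hG, one_lt_xAxis_of_faceG_pos hm hG⟩

/-- **HOLE-LIKE OVER A WHOLE BOX**: if `X ≤ x_VH(θ)` for every member (e.g. `X = 1 − 2Ψhi(q₁)` from `xVH_window_of_vhBoxCheck` and a Ψ-table entry) and `1 − 2ν < X`,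
then every member's Fermi surface at filling `ν` is hole-like: `0 < faceG(θ; ε_F)`; with `ε_F ≤ E_h`, `c ≤ c₂`, `a₁ ≤ a` and `c₂E_h < a₁²` also `1 < xAxis(θ; ε_F)`. [folklore] -/
theorem holeLike_of_le_xVH {Δ a b c ν X Eh c₂ a₁ : ℝ} (hΔ : 0 < Δ) (ha : 0 < a) (hc : 0 ≤ c) (hb : 0 ≤ b) (hν0 : 0 < ν) (hν1 : ν < 1)
    (hxX : X ≤ xVH Δ a b c) (hX : 1 - 2 * ν < X) (hEh : fermiEnergyOf Δ a b c ν ≤ Eh) (hcc : c ≤ c₂) (haa : a₁ ≤ a) (ha₁ : 0 < a₁) (hm : c₂ * Eh < a₁ ^ 2) :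
    0 < faceG Δ a c (fermiEnergyOf Δ a b c ν) ∧ 1 < xAxis Δ a c (fermiEnergyOf Δ a b c ν) := by
  have hx : 1 - 2 * ν < xVH Δ a b c := lt_of_lt_of_le hX hxX
  have hE0 := fermiEnergyOf_pos hΔ ha.ne' hc hb hν0 hν1
  have hmE : c * fermiEnergyOf Δ a b c ν < a ^ 2 :=
    calc c * fermiEnergyOf Δ a b c ν ≤ c₂ * Eh := mul_le_mul hcc hEh hE0.le (hc.trans hcc)
      _ < a₁ ^ 2 := hm
      _ ≤ a ^ 2 := by nlinarith
  exact holeLike_of_lt_xVH hΔ ha.ne' hc hb hν0 hν1 hx hmE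

end Summit.Ventures.CertifiedManyBodySolver.Downfold.Emery
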